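import Mathlib
import Summits.Ventures.PercRepro2.HalfLA12MassesA

/-!
# The masses of the `L`-half for `a₃ ~ {a₁, a₂}`, part B (blind cell PercRepro2, night-1 g37)
-/

namespace Summit.Ventures.PercRepro2

namespace HalfLA12

open CaseOne HalfLTwoMark HalfLA2B

section MassesB

variable {V : Type*} {E : Type*} [Fintype E] [DecidableEq E] {R : Type*} [CommRing R]
variable {ends : E → Sym2 V} {o a₃ b : V} {e₁ e₂ : E}

/-- **`P(Q, o ∈ H)`** for `a₃ ~ {a₁, a₂}`. -/
theorem mass_oH (p : E → R) {a₁ a₂ : V} (h : IsTwoMarkAt ends a₁ a₂ a₃ e₁ e₂) (ho3 : o ≠ a₃)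
    (_hb3 : b ≠ a₃) :
    prob p ((connEvent ends a₁ a₂)ᶜ ∩ connEvent ends a₂ o) =
      moH (p e₁) (p e₂) (cellsA12 p ends o a₁ a₂ b e₁ e₂) := by
  set p00 := Function.update (Function.update p e₁ 0) e₂ 0 with hp00
  have h1 : a₁ ≠ a₃ := h.ne_o
  have h2 : a₂ ≠ a₃ := h.ne_b
  have key := prob_twoPin p h.ne ((connEvent ends a₁ a₂)ᶜ ∩ connEvent ends a₂ o)
    (∅)
    ((connEvent ends a₁ a₂)ᶜ ∩ connEvent ends a₂ o)
    ((connEvent ends a₁ a₂)ᶜ ∩ connEvent ends a₂ o)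
    ((connEvent ends a₁ a₂)ᶜ ∩ connEvent ends a₂ o) ?_ ?_ ?_ ?_
  · rw [key]
    unfold moH cellsA12 cells10Of
    dsimp only
    rw [← hp00, prob_empty]
    have sb := split_b p00 ends b a₁ a₂ (connEvent ends a₂ o)
    linear_combination (1 - p e₁ * p e₂) * sb
  · intro ω ho hb
    rw [openCC_tt ho hb]
    simp only [Set.mem_compl_iff, Set.mem_inter_iff, mem_connEvent, Set.mem_empty_iff_false, iff_false]
    rw [conn_both_iff h ω h1 h2, conn_both_iff h ω h2 ho3,
      base2_eq_self ho hb]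
    simp only [conn_comm_iff ω a₂ a₁]
    have h11 := conn_refl ends ω a₁
    have h22 := conn_refl ends ω a₂
    tauto
  · intro ω ho hb
    rw [openCC_tf h.ne ho hb]
    simp only [Set.mem_compl_iff, Set.mem_inter_iff, mem_connEvent]
    rw [conn_open_o_iff h ω h1 h2, conn_open_o_iff h ω h2 ho3, base2_eq_self ho hb]

  · intro ω ho hb
    rw [openCC_ft ho hb]
    simp only [Set.mem_compl_iff, Set.mem_inter_iff, mem_connEvent]
    rw [conn_open_b_iff h ω h1 h2, conn_open_b_iff h ω h2 ho3, base2_eq_self ho hb]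

  · intro ω ho hb
    rw [openCC_ff ho hb, base2_eq_self ho hb]


/-- **`P(Q, o ∈ H, b ∈ L)`** for `a₃ ~ {a₁, a₂}`. -/
theorem mass_bLoH (p : E → R) {a₁ a₂ : V} (h : IsTwoMarkAt ends a₁ a₂ a₃ e₁ e₂) (ho3 : o ≠ a₃)
    (hb3 : b ≠ a₃) :
    prob p ((connEvent ends a₁ a₂)ᶜ ∩ connEvent ends a₂ o ∩ connEvent ends a₁ b) =
      mbLoH (p e₁) (p e₂) (cellsA12 p ends o a₁ a₂ b e₁ e₂) := by
  set p00 := Function.update (Function.update p e₁ 0) e₂ 0 with hp00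
  have h1 : a₁ ≠ a₃ := h.ne_o
  have h2 : a₂ ≠ a₃ := h.ne_b
  have key := prob_twoPin p h.ne ((connEvent ends a₁ a₂)ᶜ ∩ connEvent ends a₂ o ∩ connEvent ends a₁ b)
    (∅)
    ((connEvent ends a₁ a₂)ᶜ ∩ connEvent ends a₂ o ∩ connEvent ends a₁ b)
    ((connEvent ends a₁ a₂)ᶜ ∩ connEvent ends a₂ o ∩ connEvent ends a₁ b)
    ((connEvent ends a₁ a₂)ᶜ ∩ connEvent ends a₂ o ∩ connEvent ends a₁ b) ?_ ?_ ?_ ?_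
  · rw [key]
    unfold mbLoH cellsA12 cells10Of
    dsimp only
    rw [← hp00, prob_empty]
    ring
  · intro ω ho hb
    rw [openCC_tt ho hb]
    simp only [Set.mem_compl_iff, Set.mem_inter_iff, mem_connEvent, Set.mem_empty_iff_false, iff_false]
    rw [conn_both_iff h ω h1 h2, conn_both_iff h ω h2 ho3, conn_both_iff h ω h1 hb3,
      base2_eq_self ho hb]
    simp only [conn_comm_iff ω a₂ a₁]
    have h11 := conn_refl ends ω a₁
    have h22 := conn_refl ends ω a₂
    intro hc
    have hc1 := hc.1.1
    clear hc
    tauto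
  · intro ω ho hb
    rw [openCC_tf h.ne ho hb]
    simp only [Set.mem_compl_iff, Set.mem_inter_iff, mem_connEvent]
    rw [conn_open_o_iff h ω h1 h2, conn_open_o_iff h ω h2 ho3, conn_open_o_iff h ω h1 hb3, base2_eq_self ho hb]

  · intro ω ho hb
    rw [openCC_ft ho hb]
    simp only [Set.mem_compl_iff, Set.mem_inter_iff, mem_connEvent]
    rw [conn_open_b_iff h ω h1 h2, conn_open_b_iff h ω h2 ho3, conn_open_b_iff h ω h1 hb3, base2_eq_self ho hb]

  · intro ω ho hb
    rw [openCC_ff ho hb, base2_eq_self ho hb]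


/-- **`P(T, o ∈ U)`** for `a₃ ~ {a₁, a₂}`. -/
theorem mass_ToU (p : E → R) {a₁ a₂ : V} (h : IsTwoMarkAt ends a₁ a₂ a₃ e₁ e₂) (ho3 : o ≠ a₃)
    (_hb3 : b ≠ a₃) :
    prob p ((connEvent ends a₁ a₂)ᶜ ∩ connEvent ends a₂ a₃ ∩ (connEvent ends a₁ o ∪ connEvent ends a₂ o)) =
      mToU (p e₁) (p e₂) (cellsA12 p ends o a₁ a₂ b e₁ e₂) := by
  set p00 := Function.update (Function.update p e₁ 0) e₂ 0 with hp00
  have h1 : a₁ ≠ a₃ := h.ne_o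
  have h2 : a₂ ≠ a₃ := h.ne_b
  have key := prob_twoPin p h.ne ((connEvent ends a₁ a₂)ᶜ ∩ connEvent ends a₂ a₃ ∩ (connEvent ends a₁ o ∪ connEvent ends a₂ o))
    (∅)
    (∅)
    (((connEvent ends a₁ a₂)ᶜ ∩ connEvent ends a₁ o) ∪ ((connEvent ends a₁ a₂)ᶜ ∩ connEvent ends a₂ o))
    (∅) ?_ ?_ ?_ ?_
  · rw [key]
    unfold mToU cellsA12 cells10Of
    dsimp only
    rw [← hp00, prob_empty]
    have d : Disjoint ((connEvent ends a₁ a₂)ᶜ ∩ connEvent ends a₁ o) ((connEvent ends a₁ a₂)ᶜ ∩ connEvent ends a₂ o) :=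
      Set.disjoint_left.2 fun ω h1 h2 => not_both h1.1 h1.2 h2.2
    rw [prob_union_of_disjoint p00 d]
    have s1 := split_b p00 ends b a₁ a₂ (connEvent ends a₁ o)
    have s2 := split_b p00 ends b a₁ a₂ (connEvent ends a₂ o)
    linear_combination ((1 - p e₁) * p e₂) * (s1 + s2)
  · intro ω ho hb
    rw [openCC_tt ho hb]
    simp only [Set.mem_compl_iff, Set.mem_inter_iff, Set.mem_union, mem_connEvent, Set.mem_empty_iff_false, iff_false]
    rw [conn_both_iff h ω h1 h2, conn_both_a3_iff h ω h2,
      base2_eq_self ho hb]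
    simp only [conn_comm_iff ω a₂ a₁]
    have h11 := conn_refl ends ω a₁
    have h22 := conn_refl ends ω a₂
    intro hc
    have hc1 := hc.1
    clear hc
    tauto
  · intro ω ho hb
    rw [openCC_tf h.ne ho hb]
    simp only [Set.mem_compl_iff, Set.mem_inter_iff, Set.mem_union, mem_connEvent, Set.mem_empty_iff_false, iff_false]
    rw [conn_open_o_iff h ω h1 h2, conn_open_o_a3_iff h ω h2, base2_eq_self ho hb]
    simp only [conn_comm_iff ω a₂ a₁]
    intro hc
    have hc1 := hc.1
    clear hc
    tauto
  · intro ω ho hb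
    rw [openCC_ft ho hb]
    simp only [Set.mem_compl_iff, Set.mem_inter_iff, Set.mem_union, mem_connEvent]
    rw [conn_open_b_iff h ω h1 h2, conn_open_b_iff h ω h1 ho3, conn_open_b_iff h ω h2 ho3, conn_open_b_a3_iff h ω h2, base2_eq_self ho hb]
    have h22 := conn_refl ends ω a₂
    tauto
  · intro ω ho hb
    rw [openCC_ff ho hb]
    simp only [Set.mem_compl_iff, Set.mem_inter_iff, Set.mem_union, mem_connEvent, Set.mem_empty_iff_false, iff_false]
    exact fun hc => not_conn_base2 h ω h2 hc.1.2


/-- **`P(PD)`** for `a₃ ~ {a₁, a₂}`. -/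
theorem mass_PD (p : E → R) {a₁ a₂ : V} (h : IsTwoMarkAt ends a₁ a₂ a₃ e₁ e₂) (_ho3 : o ≠ a₃)
    (_hb3 : b ≠ a₃) :
    prob p ((connEvent ends a₁ a₂)ᶜ ∩ (connEvent ends a₃ a₁ ∪ connEvent ends a₃ a₂)ᶜ) =
      mPD (p e₁) (p e₂) (cellsA12 p ends o a₁ a₂ b e₁ e₂) := by
  set p00 := Function.update (Function.update p e₁ 0) e₂ 0 with hp00
  have h1 : a₁ ≠ a₃ := h.ne_o
  have h2 : a₂ ≠ a₃ := h.ne_b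
  have key := prob_twoPin p h.ne ((connEvent ends a₁ a₂)ᶜ ∩ (connEvent ends a₃ a₁ ∪ connEvent ends a₃ a₂)ᶜ)
    (∅)
    (∅)
    (∅)
    ((connEvent ends a₁ a₂)ᶜ) ?_ ?_ ?_ ?_
  · rw [key]
    unfold mPD cellsA12 cells10Of
    dsimp only
    rw [← hp00, prob_empty]
    have tot := total_cells p00 ends o b a₁ a₂
    have nn := split_NN p00 ends o a₁ a₂ b
    linear_combination ((1 - p e₁) * (1 - p e₂)) * (tot + nn)
  · intro ω ho hb
    rw [openCC_tt ho hb]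
    simp only [Set.mem_compl_iff, Set.mem_inter_iff, Set.mem_union, mem_connEvent, Set.mem_empty_iff_false, iff_false]
    rw [conn_both_iff h ω h1 h2, conn_comm_iff _ a₃ a₁, conn_comm_iff _ a₃ a₂,
      conn_both_a3_iff h ω h1, conn_both_a3_iff h ω h2, base2_eq_self ho hb]
    simp only [conn_comm_iff ω a₂ a₁]
    have h11 := conn_refl ends ω a₁
    have h22 := conn_refl ends ω a₂
    tauto
  · intro ω ho hb
    rw [openCC_tf h.ne ho hb]
    simp only [Set.mem_compl_iff, Set.mem_inter_iff, Set.mem_union, mem_connEvent, Set.mem_empty_iff_false, iff_false]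
    rw [conn_open_o_iff h ω h1 h2, conn_comm_iff _ a₃ a₁, conn_comm_iff _ a₃ a₂,
      conn_open_o_a3_iff h ω h1, conn_open_o_a3_iff h ω h2, base2_eq_self ho hb]
    have h11 := conn_refl ends ω a₁
    tauto
  · intro ω ho hb
    rw [openCC_ft ho hb]
    simp only [Set.mem_compl_iff, Set.mem_inter_iff, Set.mem_union, mem_connEvent, Set.mem_empty_iff_false, iff_false]
    rw [conn_open_b_iff h ω h1 h2, conn_comm_iff _ a₃ a₁, conn_comm_iff _ a₃ a₂,
      conn_open_b_a3_iff h ω h1, conn_open_b_a3_iff h ω h2, base2_eq_self ho hb]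
    have h22 := conn_refl ends ω a₂
    tauto
  · intro ω ho hb
    rw [openCC_ff ho hb, base2_eq_self ho hb]
    simp only [Set.mem_compl_iff, Set.mem_inter_iff, Set.mem_union, mem_connEvent]
    constructor
    · exact fun hc => hc.1
    · intro hq
      refine ⟨hq, ?_⟩
      rintro (hc | hc)
      · exact h1 (isolated_of_closed h ho hb hc)
      · exact h2 (isolated_of_closed h ho hb hc)


/-- **`P(PD, o ∈ U)`** for `a₃ ~ {a₁, a₂}`. -/
theorem mass_PDoU (p : E → R) {a₁ a₂ : V} (h : IsTwoMarkAt ends a₁ a₂ a₃ e₁ e₂) (_ho3 : o ≠ a₃)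
    (_hb3 : b ≠ a₃) :
    prob p ((connEvent ends a₁ a₂)ᶜ ∩ (connEvent ends a₃ a₁ ∪ connEvent ends a₃ a₂)ᶜ ∩ (connEvent ends a₁ o ∪ connEvent ends a₂ o)) =
      mPDoU (p e₁) (p e₂) (cellsA12 p ends o a₁ a₂ b e₁ e₂) := by
  set p00 := Function.update (Function.update p e₁ 0) e₂ 0 with hp00
  have h1 : a₁ ≠ a₃ := h.ne_o
  have h2 : a₂ ≠ a₃ := h.ne_b
  have key := prob_twoPin p h.ne ((connEvent ends a₁ a₂)ᶜ ∩ (connEvent ends a₃ a₁ ∪ connEvent ends a₃ a₂)ᶜ ∩ (connEvent ends a₁ o ∪ connEvent ends a₂ o))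
    (∅)
    (∅)
    (∅)
    (((connEvent ends a₁ a₂)ᶜ ∩ connEvent ends a₁ o) ∪ ((connEvent ends a₁ a₂)ᶜ ∩ connEvent ends a₂ o)) ?_ ?_ ?_ ?_
  · rw [key]
    unfold mPDoU cellsA12 cells10Of
    dsimp only
    rw [← hp00, prob_empty]
    have d : Disjoint ((connEvent ends a₁ a₂)ᶜ ∩ connEvent ends a₁ o) ((connEvent ends a₁ a₂)ᶜ ∩ connEvent ends a₂ o) :=
      Set.disjoint_left.2 fun ω h1 h2 => not_both h1.1 h1.2 h2.2
    rw [prob_union_of_disjoint p00 d]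
    have s1 := split_b p00 ends b a₁ a₂ (connEvent ends a₁ o)
    have s2 := split_b p00 ends b a₁ a₂ (connEvent ends a₂ o)
    linear_combination ((1 - p e₁) * (1 - p e₂)) * (s1 + s2)
  · intro ω ho hb
    rw [openCC_tt ho hb]
    simp only [Set.mem_compl_iff, Set.mem_inter_iff, Set.mem_union, mem_connEvent, Set.mem_empty_iff_false, iff_false]
    rw [conn_both_iff h ω h1 h2, conn_comm_iff _ a₃ a₁, conn_comm_iff _ a₃ a₂,
      conn_both_a3_iff h ω h1, conn_both_a3_iff h ω h2, base2_eq_self ho hb]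
    simp only [conn_comm_iff ω a₂ a₁]
    have h11 := conn_refl ends ω a₁
    have h22 := conn_refl ends ω a₂
    intro hc
    have hc1 := hc.1
    clear hc
    tauto
  · intro ω ho hb
    rw [openCC_tf h.ne ho hb]
    simp only [Set.mem_compl_iff, Set.mem_inter_iff, Set.mem_union, mem_connEvent, Set.mem_empty_iff_false, iff_false]
    rw [conn_open_o_iff h ω h1 h2, conn_comm_iff _ a₃ a₁, conn_comm_iff _ a₃ a₂,
      conn_open_o_a3_iff h ω h1, conn_open_o_a3_iff h ω h2, base2_eq_self ho hb]
    have h11 := conn_refl ends ω a₁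
    intro hc
    have hc1 := hc.1
    clear hc
    tauto
  · intro ω ho hb
    rw [openCC_ft ho hb]
    simp only [Set.mem_compl_iff, Set.mem_inter_iff, Set.mem_union, mem_connEvent, Set.mem_empty_iff_false, iff_false]
    rw [conn_open_b_iff h ω h1 h2, conn_comm_iff _ a₃ a₁, conn_comm_iff _ a₃ a₂,
      conn_open_b_a3_iff h ω h1, conn_open_b_a3_iff h ω h2, base2_eq_self ho hb]
    have h22 := conn_refl ends ω a₂
    intro hc
    have hc1 := hc.1
    clear hc
    tauto
  · intro ω ho hb
    rw [openCC_ff ho hb, base2_eq_self ho hb]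
    simp only [Set.mem_compl_iff, Set.mem_inter_iff, Set.mem_union, mem_connEvent]
    have n1 : ¬ Conn ends ω a₃ a₁ := fun hc => h1 (isolated_of_closed h ho hb hc)
    have n2 : ¬ Conn ends ω a₃ a₂ := fun hc => h2 (isolated_of_closed h ho hb hc)
    tauto


end MassesB

end HalfLA12

end Summit.Ventures.PercRepro2
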